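import Summits.QuantumFields.YangMills.Theorems.BalabanUVNodesN15KingModelToronResolvent
import Summits.QuantumFields.YangMills.Theorems.BalabanUVNodesN15KingModelComplexLinkHeatKernel
import HarnessLib

/-!
# BalabanUVNodes ∕ N15 — THE KING-MODEL RUNG (PART Ͷ-g): THE TORON HEAT KERNEL IN TWISTED PLANE WAVES AND THE DIAMAGNETIC HEAT TRACE —
# `e^{−t(−cΔ_ω+m²)}(x,y) = |T|⁻¹Σ_q e^{−t·lapSymTw(φ,q)}e^{iq·(x−y)}`, `tr e^{−t(−cΔ_ω+m²)} = Σ_q e^{−t·lapSymTw(φ,q)}` (the twisted theta function), and — PART Ϛ-o's heat-kernel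
# domination BY NAME — `Σ_q e^{−t·lapSymTw(φ,q)} ≤ Σ_q e^{−t·lapSym(q)}` for every `t ≥ 0` (the heat trace never exceeds King's; the strongest of the shifted-grid inequalities)
# (Track A, DAG node N15 = NE2; FAN-OUT v1.1 §N15 s3 «KING-MODEL RUNG … + what the curved case adds»; count-neutral)

HONEST FRAMING.  Count-neutral (cell `pub-ymgap`, seat `pub-ymgap-dag-n15-e` g44; `--supports stmt-QuantumFields-27247 --as helper` = K3ᴬ, KEY MAP v3).  One finite torus at
fixed spacing; King's `A = 0` model [King1986] is the comparison object; constant abelian (flat) `U(1)` link fields.  NOT Bałaban's `G_k(U)`, NOT [Balaban1985BackgroundPropagators]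
(3.42); NOT a node discharge (N15 of record untouched); nothing continuum ∕ ℝ⁴ ∕ OS ∕ Clay.

THE RESULTS (`M = toronOp K c m² (e^{iφ})` of PART Ͷ-a; `c ≥ 0`; Mathlib's `NormedSpace.exp` on matrices):
* §1 tools: `dft_inv_eq_conjTranspose`, `isUnit_dft`, ★ `dft_sandwich_apply` (`(dft^*·diag D·dft)(x,y) = |T|⁻¹Σ_q D_q e^{iq·(x−y)}` — the plane-wave kernel of any multiplier),
  `trace_dft_sandwich` (`tr(dft^*·diag D·dft) = Σ_q D_q`);
* §2 ★★ **`exp_neg_toronOp_eq_spectral`** (`e^{−tM} = dft^*·diag(e^{−t·lapSymTw})·dft`, Mathlib `Matrix.exp_conj'` + `Matrix.exp_diagonal`), ★★ **`exp_neg_toronOp_apply`** (THE TORON HEAT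
  KERNEL IN TWISTED PLANE WAVES), `exp_neg_toronOp_diag` (real, site-independent diagonal `|T|⁻¹Σ_q e^{−tλ_q}`), ★★ **`trace_exp_neg_toronOp`** (THE TWISTED THETA FUNCTION
  `tr e^{−tM} = Σ_q e^{−t·lapSymTw(φ,q)}`);
* §3 KING's CASE `φ = 0`: `toronOp_zero_eq_map_lapF` (`M|_{φ=0} = lapF` as a complex matrix), `exp_neg_toronOp_zero_eq_map` (`e^{−tM|_{φ=0}} = (e^{−t·lapF})` mapped to `ℂ`, `NormedSpace.map_exp`
  for the continuous ring hom `A ↦ A.map ofReal`), ★ `exp_neg_lapF_apply_eq_fourier` (King's torus heat kernel in plane waves) and `trace_exp_neg_lapF` (`= Σ_q e^{−t·lapSym(q)}`);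
* §4 DOMINATION BY NAME (PART Ϛ-o `l2_opNorm_blk_exp_neg_covLapF_le` = [DodziukMathai2006] Thm 1.5 on King's torus, at `U = toronLink e^{iφ}`, through `exp ∘ reindex = reindex ∘ exp`):
  ★★ `norm_exp_neg_toronOp_apply_le` (`|e^{−tM_ω}(x,y)| ≤ e^{−t·lapF}(x,y)`), hence ★★★ **`sum_exp_neg_lapSymTw_le`** — THE HEAT TRACE IS DIAMAGNETIC: `Σ_q e^{−t(m²+cΣ_μ(2−2cos(p′_μ(q)+φ_μ)))}
  ≤ Σ_q e^{−t(m²+cΣ_μ(2−2cos p′_μ(q)))}` for every `t ≥ 0` and every phase vector `φ` (integrating `dt`, resp. `dt∕t`, recovers PART Ͷ-b's resolvent-trace and `log det` inequalities).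

PRIOR TREE ART (by name, not restated): Ͷ-a (`toronOp`, `toronOp_twistOf_eq_spectral`, `lapSymTw`, `lapSymTw_zero`, `toronLink`, `toronLink_one`, `toronLink_mem_unitaryGroup`, `norm_twistOf_eq_one`,
`siteEquiv`), Ͱ-a `covLapF_free_eq_kronecker`, Ϛ-o `l2_opNorm_blk_exp_neg_covLapF_le` (+ `rclike_exp_ofReal`), `B5Prop11Plancherel` (`dft`, `chi`, `dft_mem_unitaryGroup`), `B5Block118`
(`dft_apply'`, `conj_dft`, `cT`), `B5LaplaceInverse` (`dft_conjTranspose_mul`, `dft_mul_conjTranspose`), `King1986.Torus` (`lapF`, `lapSym`, `chi_mul_conj_chi`∕`conj_chi_mul_chi`), `B5ToronMomentum161.twistOf_zero`,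
Mathlib (`Matrix.exp_conj'`, `Matrix.exp_diagonal`, `NormedSpace.map_exp`, `Matrix.trace_mul_cycle`, `Continuous.matrix_map`, `Continuous.matrix_submatrix`).  Dedup (rg at filing): basename 0
files; needles `dft_sandwich_apply|exp_neg_toronOp|trace_exp_neg_toronOp|sum_exp_neg_lapSymTw_le|exp_neg_lapF_apply_eq_fourier` 0 tree files.  Locators: [King1986] (4.4) p.670, (4.35) p.674,
(3.89) p.668; [DodziukMathai2006] §1 Thm 1.5; [Balaban1985BackgroundPropagators] (3.23) p.394, p.398 l.26–27 (random-walk ∕ semigroup route); [tHooft1979Flux] NPB 153 (notion only).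
0 `sorry`, 0 `def`.
-/

noncomputable section

open scoped BigOperators ComplexConjugate ComplexOrder Kronecker
open Finset Matrix Complex

namespace Summit.QuantumFields.YangMills.BalabanUVNodes.N15KingModelRung.Toron

open Literature.MathematicalPhysics.QuantumFieldTheory.LatticeDiamagneticInequality (Hopping blk)
open Literature.MathematicalPhysics.QuantumFieldTheory.Balaban1983to89.B5Prop11Plancherel
open Literature.MathematicalPhysics.QuantumFieldTheory.Balaban1983to89.B5Block118 (dft_apply' conj_dft cT)
open Literature.MathematicalPhysics.QuantumFieldTheory.Balaban1983to89.B5LaplaceInverse (dft_conjTranspose_mul dft_mul_conjTranspose)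
open Literature.MathematicalPhysics.QuantumFieldTheory.Balaban1983to89.B5ToronMomentum161 (twistOf twistOf_zero)
open Literature.MathematicalPhysics.QuantumFieldTheory.King1986.Torus (lapF lapSym chi_mul_conj_chi)
open Summit.QuantumFields.YangMills.BalabanUVNodes.N15KingModelRung.Covariant (covLapF covLapF_free_eq_kronecker l2_opNorm_blk_exp_neg_covLapF_le rclike_exp_ofReal)

variable {d : ℕ} (K : Fin (d + 1) → ℕ) [hK : ∀ μ, NeZero (K μ)]

/-! ## §1 Tools: the plane-wave kernel and the trace of a Fourier multiplier -/
section Tools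

/-- `e^{(s:ℂ)} = (e^s : ℂ)` for real `s` (Mathlib's `NormedSpace.exp` on `ℂ`). [folklore] -/
theorem complex_exp_ofReal (s : ℝ) : NormedSpace.exp ((s : ℝ) : ℂ) = ((Real.exp s : ℝ) : ℂ) := by
  rw [Complex.ofReal_exp, Complex.exp_eq_exp_ℂ]

/-- `dft⁻¹ = dft^*` (the DFT is unitary). [folklore] -/
theorem dft_inv_eq_conjTranspose : (dft K)⁻¹ = (dft K)ᴴ := Matrix.inv_eq_left_inv (dft_conjTranspose_mul K)

/-- `dft` is invertible. [folklore] -/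
theorem isUnit_dft : IsUnit (dft K) := IsUnit.of_mul_eq_one _ (dft_mul_conjTranspose K)

/-- `|T|^{−1∕2}·|T|^{−1∕2} = |T|⁻¹`. [folklore] -/
theorem cT_mul_cT : ((cT K : ℝ) : ℂ) * ((cT K : ℝ) : ℂ) = (Fintype.card (Tor K) : ℂ)⁻¹ := by
  rw [← Complex.ofReal_mul, cT, ← mul_inv, Real.mul_self_sqrt (Nat.cast_nonneg _)]; push_cast; rfl

/-- ★ THE PLANE-WAVE KERNEL OF A FOURIER MULTIPLIER: `(dft^*·diag D·dft)(x,y) = |T|⁻¹Σ_q D_q·e^{iq·(x−y)}`. [cite: King1986, (4.35) p.674; Balaban1984PropagatorsI, (1.29) p.23] -/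
theorem dft_sandwich_apply (D : Tor K → ℂ) (x y : Tor K) :
    ((dft K)ᴴ * Matrix.diagonal D * dft K) x y = (Fintype.card (Tor K) : ℂ)⁻¹ * ∑ q, D q * chi K q (x - y) := by
  rw [Matrix.mul_apply]
  simp_rw [Matrix.mul_diagonal, Matrix.conjTranspose_apply, Complex.star_def, conj_dft, dft_apply']
  rw [← cT_mul_cT, Finset.mul_sum]
  refine Finset.sum_congr rfl fun q _ => ?_
  rw [← chi_mul_conj_chi]; ring

/-- THE TRACE OF A FOURIER MULTIPLIER: `tr(dft^*·diag D·dft) = Σ_q D_q`. [cite: King1986, (3.89) p.668] -/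
theorem trace_dft_sandwich (D : Tor K → ℂ) : Matrix.trace ((dft K)ᴴ * Matrix.diagonal D * dft K) = ∑ q, D q := by
  rw [Matrix.mul_assoc, Matrix.trace_mul_comm, Matrix.mul_assoc, dft_mul_conjTranspose, Matrix.mul_one, Matrix.trace_diagonal]

end Tools

/-! ## §2 The toron heat kernel in twisted plane waves; the twisted theta function -/
section HeatKernel

variable {c : ℝ}

/-- ★★ **SPECTRAL FORM OF THE TORON HEAT KERNEL**: `e^{−t(−cΔ_ω+m²)} = dft^*·diag(e^{−t·lapSymTw(φ,q)})·dft` (`c ≥ 0`, every real `t`).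
[cite: King1986, (4.4) p.670, (4.35) p.674; DodziukMathai2006, §1 Thm 1.5] -/
theorem exp_neg_toronOp_eq_spectral (hc : 0 ≤ c) (m2 t : ℝ) (φ : Fin (d + 1) → ℝ) :
    NormedSpace.exp (-(((t : ℝ) : ℂ) • toronOp K c m2 (twistOf φ)))
      = (dft K)ᴴ * Matrix.diagonal (fun q => ((Real.exp (-(t * lapSymTw K c m2 φ q)) : ℝ) : ℂ)) * dft K := by
  rw [toronOp_twistOf_eq_spectral K hc, ← dft_inv_eq_conjTranspose]
  have hD : Matrix.diagonal (fun q => ((-(t * lapSymTw K c m2 φ q) : ℝ) : ℂ)) = -(((t : ℝ) : ℂ) • Matrix.diagonal (fun q => ((lapSymTw K c m2 φ q : ℝ) : ℂ))) := by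
    ext i j
    simp only [Matrix.diagonal_apply, Matrix.neg_apply, Matrix.smul_apply, smul_eq_mul]
    split_ifs <;> push_cast <;> ring
  have hsmul : (dft K)⁻¹ * Matrix.diagonal (fun q => ((-(t * lapSymTw K c m2 φ q) : ℝ) : ℂ)) * dft K
      = -(((t : ℝ) : ℂ) • ((dft K)⁻¹ * Matrix.diagonal (fun q => ((lapSymTw K c m2 φ q : ℝ) : ℂ)) * dft K)) := by
    rw [hD, Matrix.mul_neg, Matrix.neg_mul, Matrix.mul_smul, Matrix.smul_mul]
  rw [← hsmul, Matrix.exp_conj' _ _ (isUnit_dft K), Matrix.exp_diagonal, Pi.exp_def]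
  have hF : (fun q => NormedSpace.exp (((-(t * lapSymTw K c m2 φ q)) : ℝ) : ℂ)) = fun q => ((Real.exp (-(t * lapSymTw K c m2 φ q)) : ℝ) : ℂ) :=
    funext fun q => complex_exp_ofReal _
  rw [hF]

/-- ★★ **THE TORON HEAT KERNEL IN TWISTED PLANE WAVES**: `e^{−t(−cΔ_ω+m²)}(x,y) = |T|⁻¹Σ_q e^{−t·lapSymTw(φ,q)}·e^{iq·(x−y)}` (`c ≥ 0`, every real `t`).
[cite: King1986, (4.4) p.670, (4.35) p.674; DodziukMathai2006, §1 Thm 1.5] -/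
theorem exp_neg_toronOp_apply (hc : 0 ≤ c) (m2 t : ℝ) (φ : Fin (d + 1) → ℝ) (x y : Tor K) :
    NormedSpace.exp (-(((t : ℝ) : ℂ) • toronOp K c m2 (twistOf φ))) x y
      = (Fintype.card (Tor K) : ℂ)⁻¹ * ∑ q, ((Real.exp (-(t * lapSymTw K c m2 φ q)) : ℝ) : ℂ) * chi K q (x - y) := by
  rw [exp_neg_toronOp_eq_spectral K hc, dft_sandwich_apply]

/-- The DIAGONAL of the toron heat kernel: `e^{−tM}(x,x) = |T|⁻¹Σ_q e^{−t·lapSymTw(φ,q)}` — real, positive, the same at every site. [cite: King1986, (4.35) p.674] -/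
theorem exp_neg_toronOp_diag (hc : 0 ≤ c) (m2 t : ℝ) (φ : Fin (d + 1) → ℝ) (x : Tor K) :
    NormedSpace.exp (-(((t : ℝ) : ℂ) • toronOp K c m2 (twistOf φ))) x x
      = (((Fintype.card (Tor K) : ℝ)⁻¹ * ∑ q, Real.exp (-(t * lapSymTw K c m2 φ q)) : ℝ) : ℂ) := by
  rw [exp_neg_toronOp_apply K hc]
  simp only [sub_self, Literature.MathematicalPhysics.QuantumFieldTheory.Balaban1983to89.B5Block118.chi_zero_right, mul_one]
  push_cast; rfl

/-- ★★ **THE TWISTED THETA FUNCTION**: `tr e^{−t(−cΔ_ω+m²)} = Σ_q e^{−t·lapSymTw(φ,q)}` (`c ≥ 0`). [cite: King1986, (3.89) p.668, (4.35) p.674] -/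
theorem trace_exp_neg_toronOp (hc : 0 ≤ c) (m2 t : ℝ) (φ : Fin (d + 1) → ℝ) :
    Matrix.trace (NormedSpace.exp (-(((t : ℝ) : ℂ) • toronOp K c m2 (twistOf φ)))) = ((∑ q, Real.exp (-(t * lapSymTw K c m2 φ q)) : ℝ) : ℂ) := by
  rw [exp_neg_toronOp_eq_spectral K hc, trace_dft_sandwich]; push_cast; rfl

end HeatKernel

/-! ## §3 King's case `φ = 0`: the free torus heat kernel in plane waves -/
section Free

variable {c : ℝ}

/-- ★ KING's OPERATOR IS THE `φ = 0` TORON OPERATOR: `toronOp K c m² (e^{i0}) = (lapF K c m²)` as a complex matrix. [cite: King1986, (4.4) p.670] -/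
theorem toronOp_zero_eq_map_lapF (c m2 : ℝ) : toronOp K c m2 (twistOf (0 : Fin (d + 1) → ℝ)) = (lapF K c m2).map ((↑) : ℝ → ℂ) := by
  ext x y
  rw [twistOf_zero, toronOp_apply, show (1 : Fin (d + 1) → ℂ) = fun _ => (1 : ℂ) from rfl, toronLink_one, covLapF_free_eq_kronecker, Matrix.kroneckerMap_apply,
    Matrix.map_apply, Matrix.map_apply, Matrix.one_apply_eq, mul_one]
  rfl

open scoped Matrix.Norms.Operator in
/-- `A ↦ A.map ofReal` is a continuous ring homomorphism, so it commutes with the matrix exponential: `(e^{A})_ℂ = e^{A_ℂ}`. [folklore] -/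
theorem map_ofReal_exp (A : Matrix (Tor K) (Tor K) ℝ) : (NormedSpace.exp A).map ((↑) : ℝ → ℂ) = NormedSpace.exp (A.map ((↑) : ℝ → ℂ)) := by
  have hcont : Continuous (Complex.ofRealHom.mapMatrix : Matrix (Tor K) (Tor K) ℝ →+* Matrix (Tor K) (Tor K) ℂ) :=
    LinearMap.continuous_of_finiteDimensional (Complex.ofRealAm.mapMatrix.toLinearMap : Matrix (Tor K) (Tor K) ℝ →ₗ[ℝ] Matrix (Tor K) (Tor K) ℂ)
  exact NormedSpace.map_exp (Complex.ofRealHom.mapMatrix : Matrix (Tor K) (Tor K) ℝ →+* Matrix (Tor K) (Tor K) ℂ) hcont A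

/-- ★ `e^{−t·toronOp(e^{i0})} = (e^{−t·lapF})` mapped to `ℂ`: the `φ = 0` toron heat kernel IS King's. [cite: King1986, (4.4) p.670] -/
theorem exp_neg_toronOp_zero_eq_map (c m2 t : ℝ) :
    NormedSpace.exp (-(((t : ℝ) : ℂ) • toronOp K c m2 (twistOf (0 : Fin (d + 1) → ℝ)))) = (NormedSpace.exp (-(t • lapF K c m2))).map ((↑) : ℝ → ℂ) := by
  rw [map_ofReal_exp, toronOp_zero_eq_map_lapF]
  congr 1
  ext x y
  simp only [Matrix.neg_apply, Matrix.smul_apply, Matrix.map_apply, smul_eq_mul]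
  push_cast; ring

/-- ★ **KING's TORUS HEAT KERNEL IN PLANE WAVES**: `e^{−t(c(−Δ)+m²)}(x,y) = |T|⁻¹Σ_q e^{−t·lapSym(q)}·Re e^{iq·(x−y)}` (`c ≥ 0`). [cite: King1986, (4.4) p.670, (4.35) p.674] -/
theorem exp_neg_lapF_apply_eq_fourier (hc : 0 ≤ c) (m2 t : ℝ) (x y : Tor K) :
    (NormedSpace.exp (-(t • lapF K c m2))) x y = (Fintype.card (Tor K) : ℝ)⁻¹ * ∑ q, Real.exp (-(t * lapSym K c m2 q)) * (chi K q (x - y)).re := by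
  have h := exp_neg_toronOp_apply K hc m2 t (0 : Fin (d + 1) → ℝ) x y
  rw [exp_neg_toronOp_zero_eq_map, Matrix.map_apply, lapSymTw_zero,
    show ((Fintype.card (Tor K) : ℂ))⁻¹ = ((((Fintype.card (Tor K) : ℝ))⁻¹ : ℝ) : ℂ) by push_cast; rfl] at h
  have h2 := congrArg Complex.re h
  rw [Complex.ofReal_re, Complex.re_ofReal_mul, Complex.re_sum] at h2
  rw [h2]
  congr 1
  exact Finset.sum_congr rfl fun q _ => Complex.re_ofReal_mul _ _

/-- ★ KING's HEAT TRACE: `tr e^{−t(c(−Δ)+m²)} = Σ_q e^{−t·lapSym(q)}` (`c ≥ 0`). [cite: King1986, (3.89) p.668, (4.35) p.674] -/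
theorem trace_exp_neg_lapF (hc : 0 ≤ c) (m2 t : ℝ) : Matrix.trace (NormedSpace.exp (-(t • lapF K c m2))) = ∑ q, Real.exp (-(t * lapSym K c m2 q)) := by
  have h := trace_exp_neg_toronOp K hc m2 t (0 : Fin (d + 1) → ℝ)
  rw [exp_neg_toronOp_zero_eq_map, lapSymTw_zero] at h
  have h2 : Matrix.trace ((NormedSpace.exp (-(t • lapF K c m2))).map ((↑) : ℝ → ℂ)) = ((Matrix.trace (NormedSpace.exp (-(t • lapF K c m2))) : ℝ) : ℂ) := by
    simp only [Matrix.trace, Matrix.diag_apply, Matrix.map_apply, Complex.ofReal_sum]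
  rw [h2] at h
  exact_mod_cast h

end Free

/-! ## §4 Domination: the heat trace is diamagnetic -/
section Domination

variable {c : ℝ}

open scoped Matrix.Norms.Operator in
/-- `exp` commutes with the reindexing `T × Unit ≃ T` (a continuous ring isomorphism). [folklore] -/
theorem exp_reindex_siteEquiv (A : Matrix (Tor K × Unit) (Tor K × Unit) ℂ) :
    NormedSpace.exp (Matrix.reindex (siteEquiv K) (siteEquiv K) A) = Matrix.reindex (siteEquiv K) (siteEquiv K) (NormedSpace.exp A) := by
  have hcont : Continuous (Matrix.reindexAlgEquiv ℂ ℂ (siteEquiv K) : Matrix (Tor K × Unit) (Tor K × Unit) ℂ ≃ₐ[ℂ] Matrix (Tor K) (Tor K) ℂ) :=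
    LinearMap.continuous_of_finiteDimensional ((Matrix.reindexAlgEquiv ℂ ℂ (siteEquiv K)).toLinearMap)
  have h := NormedSpace.map_exp (Matrix.reindexAlgEquiv ℂ ℂ (siteEquiv K) : Matrix (Tor K × Unit) (Tor K × Unit) ℂ ≃ₐ[ℂ] Matrix (Tor K) (Tor K) ℂ) hcont A
  simp only [Matrix.coe_reindexAlgEquiv] at h
  exact h.symm

open scoped Matrix.Norms.L2Operator in
/-- The `ℓ²` operator norm of a `1 × 1` matrix dominates (indeed equals) the modulus of its entry. [folklore] -/
theorem norm_unit_entry_le_l2_opNorm (B : Matrix Unit Unit ℂ) : ‖B () ()‖ ≤ ‖B‖ := by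
  have h := (Matrix.toEuclideanCLM (𝕜 := ℂ) (n := Unit) B).le_opNorm (WithLp.toLp 2 (Pi.single () (1 : ℂ)))
  rw [Matrix.toEuclideanCLM_toLp, Matrix.mulVec_single_one, ← Matrix.cstar_norm_def] at h
  have h1 : ‖(WithLp.toLp 2 (Pi.single () (1 : ℂ)) : EuclideanSpace ℂ Unit)‖ = 1 := by
    rw [EuclideanSpace.norm_eq]; simp
  have h2 : ‖(WithLp.toLp 2 (B.col ()) : EuclideanSpace ℂ Unit)‖ = ‖B () ()‖ := by
    rw [EuclideanSpace.norm_eq]; simp [Matrix.col_apply]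
  rw [h1, mul_one, h2] at h
  exact h

omit hK in
/-- Reindexing along `T × Unit ≃ T` is linear: `−(t • reindex A) = reindex (−(t • A))`. [folklore] -/
theorem neg_smul_reindex_siteEquiv (t : ℂ) (A : Matrix (Tor K × Unit) (Tor K × Unit) ℂ) :
    -(t • Matrix.reindex (siteEquiv K) (siteEquiv K) A) = Matrix.reindex (siteEquiv K) (siteEquiv K) (-(t • A)) := by
  ext x y; rfl

/-- ★★ **THE TORON HEAT KERNEL IS DOMINATED BY KING's** (PART Ϛ-o `l2_opNorm_blk_exp_neg_covLapF_le` = [DodziukMathai2006] Thm 1.5, at `U = toronLink ω`): for unit `ω`, `c ≥ 0`, `t ≥ 0`,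
`|e^{−t(−cΔ_ω+m²)}(x,y)| ≤ e^{−t(c(−Δ)+m²)}(x,y)`. [cite: DodziukMathai2006, §1 Thm 1.5; King1986, (4.4) p.670] -/
theorem norm_exp_neg_toronOp_apply_le (hc : 0 ≤ c) (m2 : ℝ) {t : ℝ} (ht : 0 ≤ t) {ω : Fin (d + 1) → ℂ} (hω : ∀ μ, ‖ω μ‖ = 1) (x y : Tor K) :
    ‖NormedSpace.exp (-(((t : ℝ) : ℂ) • toronOp K c m2 ω)) x y‖ ≤ (NormedSpace.exp (-(t • lapF K c m2))) x y := by
  have h := l2_opNorm_blk_exp_neg_covLapF_le K (𝕜 := ℂ) (n := Unit) hc m2 ht (toronLink_mem_unitaryGroup K hω) x y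
  have hre : NormedSpace.exp (-(((t : ℝ) : ℂ) • toronOp K c m2 ω)) x y
      = blk (NormedSpace.exp (-(((t : ℝ) : ℂ) • covLapF K c m2 (toronLink K ω)))) x y () () := by
    rw [toronOp, neg_smul_reindex_siteEquiv, exp_reindex_siteEquiv]; rfl
  rw [hre]
  exact le_trans (norm_unit_entry_le_l2_opNorm _) h

/-- ★★★ **THE HEAT TRACE IS DIAMAGNETIC — A TRIGONOMETRIC INEQUALITY ON THE SHIFTED GRID FOR EVERY `t ≥ 0`**: for every period vector, `c ≥ 0`, every `m²`, every phase vector `φ`,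
`Σ_q e^{−t(m² + cΣ_μ(2 − 2cos(p′_μ(q) + φ_μ)))} ≤ Σ_q e^{−t(m² + cΣ_μ(2 − 2cos p′_μ(q)))}` — the toron heat trace never exceeds King's (sum of §4's diagonal domination over the sites;
integrating `dt` gives PART Ͷ-b's resolvent-trace inequality, integrating `dt∕t` its `log det` inequality). [cite: DodziukMathai2006, §1 Thm 1.5; King1986, (3.89) p.668, (4.35) p.674] -/
theorem sum_exp_neg_lapSymTw_le (hc : 0 ≤ c) (m2 : ℝ) {t : ℝ} (ht : 0 ≤ t) (φ : Fin (d + 1) → ℝ) :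
    ∑ q : Tor K, Real.exp (-(t * lapSymTw K c m2 φ q)) ≤ ∑ q : Tor K, Real.exp (-(t * lapSym K c m2 q)) := by
  rw [← trace_exp_neg_lapF K hc m2 t]
  have htr := congrArg Complex.re (trace_exp_neg_toronOp K hc m2 t φ)
  simp only [Matrix.trace, Matrix.diag_apply, Complex.re_sum, Complex.ofReal_re] at htr
  rw [← htr]
  simp only [Matrix.trace, Matrix.diag_apply]
  exact Finset.sum_le_sum fun x _ => le_trans (Complex.re_le_norm _) (norm_exp_neg_toronOp_apply_le K hc m2 ht (norm_twistOf_eq_one φ) x x)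

end Domination

end Summit.QuantumFields.YangMills.BalabanUVNodes.N15KingModelRung.Toron

end
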